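import Mathlib.MeasureTheory.Function.LpSpace.Complete
import Literature.Analysis.FluidPDE.FractionalNSReynoldsWeakIdentity
import HarnessLib

/-!
# `C⁰_t L²_x` limits of fractional Navier–Stokes–Reynolds flows are Luo–Titi weak solutions

Analysis/FluidPDE proofs file (theorems, plus the two bookkeeping definitions `Torus.teleLim`,
`Torus.stLim` of the limit object); the `L^∞_t L²_x` companion of the uniform-limit statement
`Torus.isWeakFracNSSolutionOn_of_unifLimit` of `FluidPDE/FractionalNSReynoldsLimit`. It formalises the limit step of the proof of the main theorem
of T. Luo, E. S. Titi, *Non-uniqueness of weak solutions to hyperviscous Navier–Stokes equations: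
on sharpness of J.-L. Lions exponent*, Calc. Var. PDE 59 (2020) = arXiv:1808.07595, §2.1, p. 4:

> "It follows from (2.4) that `∑ ‖v_{q+1} - v_q‖_{L^∞_t L²_x} = ∑ ‖w_{q+1}‖_{L^∞_t L²_x} ≤
> C ∑ δ_{q+1}^{1/2} < ∞`. Thus `v_q` converge strongly to some `v ∈ C⁰_t L²_x`. Since
> `‖R_{q+1}‖_{L^∞_t L¹_x} → 0`, as `q → ∞`, `v` is a weak solution to the FVNSE (1.1)."

for the iterates `(v_q, R_q)` of the Iteration Lemma (`Torus.LuoTiti2020_iterationLemma`,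
`FluidPDE/FractionalNSReynolds`), in the solution notions of the tree: classical solutions of the
fractional Navier–Stokes–Reynolds system `Torus.IsFracNSReynoldsOn univ θ ν v p R` on `ℝ × T^d`
and Luo–Titi's Def. 1.1 `Torus.IsWeakFracNSSolutionLine θ ν v` (`FluidPDE/FractionalNSTorus`).

## Main statements (all proved)

* `Torus.teleLim`, `Torus.stLim` — the telescoping limit `v₀ + ∑_q (v_{q+1} - v_q)` of a sequence
  of (space–time) fields, slice-wise and pointwise (`tsum`); `Torus.ae_tendsto_stLim`
  (slice-wise a.e. convergence when `∑ sup_t ‖v_{q+1}(t) - v_q(t)‖_{L²} < ∞`),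
  `Torus.eLpNorm_lim_sub_le` (`‖v(t) - v_q(t)‖_{L^p} ≤ ∑_{k ≥ q} c_k`, Fatou),
  `Torus.aestronglyMeasurable_uncurry_stLim` (joint measurability of the limit on `ℝ × T^d`: the
  exceptional set of the product measure is measurable with null time slices),
  `Torus.stLim_L2_facts` (uniform `L²` bookkeeping).
* `Torus.isWeakFracNSSolutionLine_stLim` — **the limit theorem**: if `(v_q, p_q, R_q)` solve the
  fractional Navier–Stokes–Reynolds system on `ℝ × T^d` (`θ ≥ 0`), all `v_q` vanish off a bounded
  time interval, `sup_t ‖v_{q+1}(t) - v_q(t)‖_{L²} ≤ β_q` with `∑ β_q < ∞`, and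
  `sup_t ‖R_q(t)‖_{L¹} → 0`, then `stLim v` is a weak solution in Luo–Titi's sense (measurable,
  slices in `L²`, weakly — indeed strongly — `L²`-continuous in time, weakly divergence free, and
  the momentum identity `Torus.integral_weakFunctional_stLim_eq_zero`, obtained from the weak
  identity with Reynolds defect `Torus.IsFracNSReynoldsOn.weak_identity_line` of
  `FluidPDE/FractionalNSReynoldsWeakIdentity`, the bound `‖∫∑ⱼ⟪R^{(j)}, ∂ⱼψ⟫‖ ≤ card d · ‖∇ψ‖_∞ ‖R‖_{L¹}`, and the
  `L²`-stability of the weak functional `Torus.enorm_integral_fullIntegrand_sub_le`, uniformly in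
  time).

Supporting [folklore] lemmas: vanishing of `∂ₜψ`, `∂ⱼψ`, `(-Δ)^θψ` off the temporal support,
uniform bounds for test fields (`Torus.exists_bound_timeDeriv/partialDeriv/fracLaplacian`),
Cauchy–Schwarz for `L²` pairings in `[0,∞]` form, continuity of pairings `t ↦ ∫⟪u(t), φ⟫` for
bounded jointly continuous `u` and under uniform `L²` limits, continuity in time of the weak
functional of a smooth field (`Torus.continuous_weakFunctional`).

## References

* T. Luo, E. S. Titi, Calc. Var. PDE 59 (2020), Paper 92 = arXiv:1808.07595 (held text): §1
  Def. 1.1, §2.1 (2.1), the Iteration Lemma (Lemma 1) and the proof of Theorem 1 (p. 4).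
  [`LuoTiti2020`]
* T. Buckmaster, C. De Lellis, L. Székelyhidi Jr., V. Vicol, CPAM 72 (2019), §2.2 (the limit
  step of a convex-integration scheme, `C⁰` version: `Torus.isWeakEulerSolutionOn_of_unifLimit`
  of `FluidPDE/EulerReynolds`). [`BuckmasterEtAl2018`]
-/

noncomputable section

open MeasureTheory Set Filter Topology
open scoped InnerProductSpace ContDiff ENNReal

namespace Literature.Analysis.FluidPDE

namespace Torus

open FunctionSpaces FunctionSpaces.Torus

variable {d : Type*} [Fintype d] [DecidableEq d]

section TestFieldVanishing

variable {F : Type*} [NormedAddCommGroup F] [NormedSpace ℝ F]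

omit [Fintype d] [DecidableEq d] in
/-- For a space–time field vanishing at all times off `[a, b]`, the two-sided time derivative
vanishes off `[a, b]` (the complement is open). [folklore] -/
theorem timeDeriv_eq_zero_of_forall_not_mem_Icc {ψ : ℝ → UnitAddTorus d → F} {a b : ℝ}
    (hψ : ∀ t, t ∉ Icc a b → ψ t = 0) {t : ℝ} (ht : t ∉ Icc a b) (x : UnitAddTorus d) :
    timeDeriv ψ t x = 0 := by
  have hev : (fun τ => ψ τ x) =ᶠ[𝓝 t] fun _ => (0 : F) := by
    filter_upwards [isClosed_Icc.isOpen_compl.mem_nhds ht] with τ hτ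
    simp [hψ τ hτ]
  rw [timeDeriv, hev.deriv_eq, deriv_const]

omit [Fintype d] in
/-- Slices of a field vanishing off `[a, b]` have vanishing spatial partial derivatives off
`[a, b]`. [folklore] -/
theorem partialDeriv_slice_eq_zero_of_forall_not_mem_Icc {ψ : ℝ → UnitAddTorus d → F} {a b : ℝ}
    (hψ : ∀ t, t ∉ Icc a b → ψ t = 0) {t : ℝ} (ht : t ∉ Icc a b) (j : d) (x : UnitAddTorus d) :
    partialDeriv j (ψ t) x = 0 := by
  rw [hψ t ht]
  unfold partialDeriv Torus.lineDeriv
  simp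

end TestFieldVanishing


section Telescoping

/-! ## Telescoping `L²`-summable sequences on a probability space -/

variable {X : Type*} [MeasurableSpace X] {μ : Measure X}
variable {E : Type*} [NormedAddCommGroup E] [NormedSpace ℝ E] [CompleteSpace E]

/-- The telescoping limit `f₀ + ∑_q (f_{q+1} - f_q)` of a sequence of functions, pointwise
(`tsum`, junk value `f₀ x` where the series diverges). [folklore] -/
def teleLim (f : ℕ → X → E) (x : X) : E :=
  f 0 x + ∑' q, (f (q + 1) x - f q x)

omit [NormedSpace ℝ E] [CompleteSpace E] in
/-- `∫ ∑_q ‖f_{q+1} - f_q‖ ≤ ∑_q ‖f_{q+1} - f_q‖_{L²}` on a probability space. [folklore] -/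
theorem lintegral_tsum_enorm_sub_le [IsProbabilityMeasure μ] {f : ℕ → X → E}
    (hf : ∀ q, AEStronglyMeasurable (f q) μ) :
    ∫⁻ x, ∑' q, ‖f (q + 1) x - f q x‖ₑ ∂μ ≤ ∑' q, eLpNorm (f (q + 1) - f q) 2 μ := by
  have hmeas : ∀ q, AEMeasurable (fun x => ‖f (q + 1) x - f q x‖ₑ) μ := fun q =>
    ((hf (q + 1)).sub (hf q)).enorm
  rw [lintegral_tsum hmeas]
  refine ENNReal.tsum_le_tsum fun q => ?_
  calc ∫⁻ x, ‖f (q + 1) x - f q x‖ₑ ∂μ = eLpNorm (f (q + 1) - f q) 1 μ := by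
        rw [eLpNorm_one_eq_lintegral_enorm]; rfl
    _ ≤ eLpNorm (f (q + 1) - f q) 2 μ :=
        eLpNorm_le_eLpNorm_of_exponent_le one_le_two ((hf (q + 1)).sub (hf q))

omit [NormedSpace ℝ E] [CompleteSpace E] in
/-- If `∑_q ‖f_{q+1} - f_q‖_{L²} < ∞` then `∑_q ‖f_{q+1}(x) - f_q(x)‖ < ∞` for a.e. `x`. [folklore] -/
theorem ae_summable_norm_sub [IsProbabilityMeasure μ] {f : ℕ → X → E}
    (hf : ∀ q, AEStronglyMeasurable (f q) μ) {β : ℕ → ℝ≥0∞}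
    (hβ : ∀ q, eLpNorm (f (q + 1) - f q) 2 μ ≤ β q) (hβs : ∑' q, β q ≠ ⊤) :
    ∀ᵐ x ∂μ, Summable fun q => ‖f (q + 1) x - f q x‖ := by
  have hmeas : ∀ q, AEMeasurable (fun x => ‖f (q + 1) x - f q x‖ₑ) μ := fun q =>
    ((hf (q + 1)).sub (hf q)).enorm
  have hG : AEMeasurable (fun x => ∑' q, ‖f (q + 1) x - f q x‖ₑ) μ := AEMeasurable.tsum hmeas
  have hfin : ∫⁻ x, ∑' q, ‖f (q + 1) x - f q x‖ₑ ∂μ ≠ ⊤ :=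
    ne_top_of_le_ne_top hβs
      ((lintegral_tsum_enorm_sub_le hf).trans (ENNReal.tsum_le_tsum hβ))
  filter_upwards [ae_lt_top' hG hfin] with x hx
  have h1 : Summable fun q => ‖f (q + 1) x - f q x‖₊ := by
    rw [← ENNReal.tsum_coe_ne_top_iff_summable]
    exact hx.ne
  simpa using NNReal.summable_coe.2 h1

omit [MeasurableSpace X] [NormedSpace ℝ E] in
/-- Where the increments are absolutely summable, `f_q(x) → teleLim f (x)`. [folklore] -/
theorem tendsto_teleLim_of_summable {f : ℕ → X → E} {x : X}
    (hx : Summable fun q => ‖f (q + 1) x - f q x‖) :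
    Tendsto (fun q => f q x) atTop (𝓝 (teleLim f x)) := by
  have h1 := (Summable.of_norm hx).hasSum.tendsto_sum_nat
  have h2 : (fun n => ∑ i ∈ Finset.range n, (f (i + 1) x - f i x)) = fun n => f n x - f 0 x :=
    funext fun n => Finset.sum_range_sub (fun i => f i x) n
  rw [h2] at h1
  have h3 := h1.const_add (f 0 x)
  simp only [add_sub_cancel] at h3
  exact h3

omit [NormedSpace ℝ E] [CompleteSpace E] in
/-- **`L^p` distance to the telescoping limit**: if `f_n → g` a.e. and
`‖f_{k+1} - f_k‖_{L^p} ≤ c_k`, then `‖g - f_q‖_{L^p} ≤ ∑_k c_{q+k}` (Fatou). [folklore] -/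
theorem eLpNorm_lim_sub_le {f : ℕ → X → E} {g : X → E} (hf : ∀ q, AEStronglyMeasurable (f q) μ)
    (hlim : ∀ᵐ x ∂μ, Tendsto (fun n => f n x) atTop (𝓝 (g x))) {p : ℝ≥0∞} (hp : 1 ≤ p)
    {c : ℕ → ℝ≥0∞} (hc : ∀ q, eLpNorm (f (q + 1) - f q) p μ ≤ c q) (q : ℕ) :
    eLpNorm (g - f q) p μ ≤ ∑' k, c (q + k) := by
  have hlim' : ∀ᵐ x ∂μ, Tendsto (fun n => (f n - f q) x) atTop (𝓝 ((g - f q) x)) := by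
    filter_upwards [hlim] with x hx
    exact hx.sub_const (f q x)
  refine Lp.eLpNorm_le_of_ae_tendsto (u := atTop) ?_ (fun n => (hf n).sub (hf q)) hlim'
  rw [eventually_atTop]
  refine ⟨q, fun n hn => ?_⟩
  obtain ⟨m, rfl⟩ := Nat.exists_eq_add_of_le hn
  have htel : f (q + m) - f q = ∑ k ∈ Finset.range m, (f (q + k + 1) - f (q + k)) := by
    have h := Finset.sum_range_sub (fun k => f (q + k)) m
    simp only [add_zero] at h
    rw [← h]
    rfl
  rw [htel]
  calc eLpNorm (∑ k ∈ Finset.range m, (f (q + k + 1) - f (q + k))) p μ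
      ≤ ∑ k ∈ Finset.range m, eLpNorm (f (q + k + 1) - f (q + k)) p μ :=
        eLpNorm_sum_le (fun k _ => (hf _).sub (hf _)) hp
    _ ≤ ∑ k ∈ Finset.range m, c (q + k) := Finset.sum_le_sum fun k _ => hc (q + k)
    _ ≤ ∑' k, c (q + k) := ENNReal.sum_le_tsum _

omit [NormedSpace ℝ E] in
/-- Tails of a convergent series in `[0, ∞]` tend to zero, in the `ε`–`N` form used below. [folklore] -/
theorem exists_tsum_add_le {c : ℕ → ℝ≥0∞} (hc : ∑' q, c q ≠ ⊤) {ε : ℝ≥0∞} (hε : 0 < ε) :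
    ∃ N, ∀ q ≥ N, ∑' k, c (q + k) ≤ ε := by
  have h := ENNReal.tendsto_atTop_zero.1 (ENNReal.tendsto_sum_nat_add c hc) ε hε
  obtain ⟨N, hN⟩ := h
  refine ⟨N, fun q hq => ?_⟩
  have := hN q hq
  simpa only [add_comm] using this

end Telescoping

section SpaceTimeLimit

/-! ## The telescoping limit of a sequence of space–time fields -/

variable {E : Type*} [NormedAddCommGroup E] [CompleteSpace E]

/-- The slice-wise telescoping limit of a sequence of space–time fields:
`stLim v t = teleLim (q ↦ v q t)`, i.e. `v₀(t, x) + ∑_q (v_{q+1}(t, x) - v_q(t, x))`. [folklore] -/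
def stLim (v : ℕ → ℝ → UnitAddTorus d → E) (t : ℝ) : UnitAddTorus d → E :=
  teleLim (fun q => v q t)

omit [Fintype d] [DecidableEq d] [CompleteSpace E] in
/-- Unfolding `stLim`. [folklore] -/
theorem stLim_apply (v : ℕ → ℝ → UnitAddTorus d → E) (t : ℝ) (x : UnitAddTorus d) :
    stLim v t x = v 0 t x + ∑' q, (v (q + 1) t x - v q t x) := rfl

omit [Fintype d] [DecidableEq d] [CompleteSpace E] in
/-- At times where all fields vanish, so does the limit. [folklore] -/
theorem stLim_eq_zero {v : ℕ → ℝ → UnitAddTorus d → E} {t : ℝ} (h : ∀ q, v q t = 0) :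
    stLim v t = 0 := by
  funext x
  simp [stLim_apply, h]

omit [DecidableEq d] in
/-- **Slice-wise a.e. convergence to the limit.** [folklore] -/
theorem ae_tendsto_stLim {v : ℕ → ℝ → UnitAddTorus d → E}
    (hv : ∀ q t, AEStronglyMeasurable (v q t) volume) {β : ℕ → ℝ≥0∞}
    (hβ : ∀ q t, eLpNorm (v (q + 1) t - v q t) 2 volume ≤ β q) (hβs : ∑' q, β q ≠ ⊤) (t : ℝ) :
    ∀ᵐ x, Tendsto (fun q => v q t x) atTop (𝓝 (stLim v t x)) := by
  filter_upwards [ae_summable_norm_sub (fun q => hv q t) (fun q => hβ q t) hβs] with x hx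
  exact tendsto_teleLim_of_summable hx

omit [DecidableEq d] in
/-- **Joint measurability of the limit field**: if every `v_q` is jointly continuous on
`ℝ × T^d` and the increments are `L²`-summable uniformly in time, the limit `stLim v` is
a.e.-strongly measurable on `ℝ × T^d` (it is the a.e. limit of the `v_q` for the product
measure: the exceptional set is measurable with null time slices). [folklore] -/
theorem aestronglyMeasurable_uncurry_stLim [SecondCountableTopology E] [MeasurableSpace E]
    [BorelSpace E] {v : ℕ → ℝ → UnitAddTorus d → E}
    (hv : ∀ q, Continuous (Function.uncurry (v q))) {β : ℕ → ℝ≥0∞}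
    (hβ : ∀ q t, eLpNorm (v (q + 1) t - v q t) 2 volume ≤ β q) (hβs : ∑' q, β q ≠ ⊤) :
    AEStronglyMeasurable (Function.uncurry (stLim v))
      ((volume : Measure ℝ).prod (volume : Measure (UnitAddTorus d))) := by
  set G : ℝ × UnitAddTorus d → ℝ≥0∞ := fun z => ∑' q, ‖v (q + 1) z.1 z.2 - v q z.1 z.2‖ₑ with hG_def
  have hGm : Measurable G :=
    Measurable.tsum fun q => (((hv (q + 1)).sub (hv q)).measurable).enorm
  set s : Set (ℝ × UnitAddTorus d) := {z | G z = ⊤} with hs_def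
  have hsm : MeasurableSet s := hGm (measurableSet_singleton ⊤)
  have hnull : ((volume : Measure ℝ).prod (volume : Measure (UnitAddTorus d))) s = 0 := by
    rw [Measure.measure_prod_null hsm]
    refine ae_of_all _ fun t => ?_
    have hslice : ∀ᵐ x, ∑' q, ‖v (q + 1) t x - v q t x‖ₑ < ⊤ := by
      have hGt : AEMeasurable (fun x => ∑' q, ‖v (q + 1) t x - v q t x‖ₑ) volume :=
        (hGm.comp (measurable_const.prodMk measurable_id)).aemeasurable
      have hvt : ∀ q, AEStronglyMeasurable (v q t) volume := fun q =>
        ((hv q).comp (continuous_const.prodMk continuous_id)).aestronglyMeasurable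
      exact ae_lt_top' hGt (ne_top_of_le_ne_top hβs
        ((lintegral_tsum_enorm_sub_le hvt).trans (ENNReal.tsum_le_tsum fun q => hβ q t)))
    have h0 : volume {x : UnitAddTorus d | ¬ (∑' q, ‖v (q + 1) t x - v q t x‖ₑ < ⊤)} = 0 :=
      ae_iff.1 hslice
    simp only [Pi.zero_apply]
    convert h0 using 2
    ext x
    simp [hs_def, hG_def]
  have hae : ∀ᵐ z ∂((volume : Measure ℝ).prod (volume : Measure (UnitAddTorus d))),
      Tendsto (fun q => Function.uncurry (v q) z) atTop (𝓝 (Function.uncurry (stLim v) z)) := by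
    rw [ae_iff]
    refine measure_mono_null (fun z hz => ?_) hnull
    by_contra hzs
    apply hz
    have hfin : G z < ⊤ := lt_top_iff_ne_top.2 hzs
    have hsum : Summable fun q => ‖v (q + 1) z.1 z.2 - v q z.1 z.2‖ := by
      have h1 : Summable fun q => ‖v (q + 1) z.1 z.2 - v q z.1 z.2‖₊ := by
        rw [← ENNReal.tsum_coe_ne_top_iff_summable]
        exact hfin.ne
      simpa using NNReal.summable_coe.2 h1
    exact tendsto_teleLim_of_summable hsum
  exact aestronglyMeasurable_of_tendsto_ae atTop (fun q => (hv q).aestronglyMeasurable) hae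

omit [CompleteSpace E] in
/-- `‖f_{q+m} - f_q‖_{L^p} ≤ ∑_{k<m} c_{q+k} ≤ ∑_k c_{q+k}` (finite telescoping and the triangle
inequality). [folklore] -/
theorem eLpNorm_sub_le_tsum {X : Type*} [MeasurableSpace X] {μ : Measure X} {f : ℕ → X → E}
    (hf : ∀ q, AEStronglyMeasurable (f q) μ) {p : ℝ≥0∞} (hp : 1 ≤ p)
    {c : ℕ → ℝ≥0∞} (hc : ∀ q, eLpNorm (f (q + 1) - f q) p μ ≤ c q) (q m : ℕ) :
    eLpNorm (f (q + m) - f q) p μ ≤ ∑' k, c (q + k) := by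
  have htel : f (q + m) - f q = ∑ k ∈ Finset.range m, (f (q + k + 1) - f (q + k)) := by
    have h := Finset.sum_range_sub (fun k => f (q + k)) m
    simp only [add_zero] at h
    rw [← h]
    rfl
  rw [htel]
  calc eLpNorm (∑ k ∈ Finset.range m, (f (q + k + 1) - f (q + k))) p μ
      ≤ ∑ k ∈ Finset.range m, eLpNorm (f (q + k + 1) - f (q + k)) p μ :=
        eLpNorm_sum_le (fun k _ => (hf _).sub (hf _)) hp
    _ ≤ ∑ k ∈ Finset.range m, c (q + k) := Finset.sum_le_sum fun k _ => hc (q + k)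
    _ ≤ ∑' k, c (q + k) := ENNReal.sum_le_tsum _

end SpaceTimeLimit

section L2Tools

/-! ## `L²` pairing tools -/

variable {X : Type*} [MeasurableSpace X] {μ : Measure X}
variable {V : Type*} [NormedAddCommGroup V] [InnerProductSpace ℝ V]

omit [InnerProductSpace ℝ V] in
/-- Cauchy–Schwarz: `∫⁻ ‖F‖ ‖G‖ ≤ ‖F‖₂ ‖G‖₂`. [folklore] -/
theorem lintegral_enorm_mul_enorm_le {W : Type*} [NormedAddCommGroup W] {F : X → V} {G : X → W}
    (hF : AEStronglyMeasurable F μ) (hG : AEStronglyMeasurable G μ) :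
    ∫⁻ x, ‖F x‖ₑ * ‖G x‖ₑ ∂μ ≤ eLpNorm F 2 μ * eLpNorm G 2 μ := by
  calc ∫⁻ x, ‖F x‖ₑ * ‖G x‖ₑ ∂μ
      ≤ (∫⁻ x, ‖F x‖ₑ ^ (2 : ℝ) ∂μ) ^ (1 / (2 : ℝ)) * (∫⁻ x, ‖G x‖ₑ ^ (2 : ℝ) ∂μ) ^ (1 / (2 : ℝ)) :=
        ENNReal.lintegral_mul_le_Lp_mul_Lq μ Real.HolderConjugate.two_two hF.enorm hG.enorm
    _ = eLpNorm F 2 μ * eLpNorm G 2 μ := by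
        rw [eLpNorm_eq_lintegral_rpow_enorm_toReal two_ne_zero ENNReal.ofNat_ne_top,
          eLpNorm_eq_lintegral_rpow_enorm_toReal two_ne_zero ENNReal.ofNat_ne_top, ENNReal.toReal_ofNat]

/-- `‖∫ ⟪F, G⟫‖ₑ ≤ ‖F‖₂ ‖G‖₂`. [folklore] -/
theorem enorm_integral_inner_le_eLpNorm_two {F G : X → V} (hF : AEStronglyMeasurable F μ)
    (hG : AEStronglyMeasurable G μ) :
    ‖∫ x, ⟪F x, G x⟫_ℝ ∂μ‖ₑ ≤ eLpNorm F 2 μ * eLpNorm G 2 μ := by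
  refine (enorm_integral_le_lintegral_enorm _).trans ?_
  refine le_trans (lintegral_mono fun x => ?_) (lintegral_enorm_mul_enorm_le hF hG)
  rw [← ofReal_norm, ← ofReal_norm, ← ofReal_norm, ← ENNReal.ofReal_mul (norm_nonneg _)]
  exact ENNReal.ofReal_le_ofReal (norm_inner_le_norm _ _)

/-- Real form: `|∫ ⟪F, G⟫| ≤ (‖F‖₂ ‖G‖₂).toReal` when the right side is finite. [folklore] -/
theorem norm_integral_inner_le_toReal {F G : X → V} (hF : AEStronglyMeasurable F μ)
    (hG : AEStronglyMeasurable G μ) (hfin : eLpNorm F 2 μ * eLpNorm G 2 μ ≠ ⊤) :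
    ‖∫ x, ⟪F x, G x⟫_ℝ ∂μ‖ ≤ (eLpNorm F 2 μ * eLpNorm G 2 μ).toReal := by
  have h := enorm_integral_inner_le_eLpNorm_two hF hG
  rw [← ofReal_norm] at h
  exact (ENNReal.ofReal_le_iff_le_toReal hfin).1 h

omit [InnerProductSpace ℝ V] in
/-- On a probability space, `∫⁻ ‖F‖ ≤ ‖F‖₂`. [folklore] -/
theorem lintegral_enorm_le_eLpNorm_two [IsProbabilityMeasure μ] {F : X → V}
    (hF : AEStronglyMeasurable F μ) : ∫⁻ x, ‖F x‖ₑ ∂μ ≤ eLpNorm F 2 μ := by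
  rw [← eLpNorm_one_eq_lintegral_enorm]
  exact eLpNorm_le_eLpNorm_of_exponent_le one_le_two hF

omit [InnerProductSpace ℝ V] in
/-- On a probability space, an a.e. pointwise bound `‖F‖ ≤ C` gives `‖F‖_{L^p} ≤ C`. [folklore] -/
theorem eLpNorm_le_of_bound [IsProbabilityMeasure μ] {F : X → V} {C : ℝ} (p : ℝ≥0∞)
    (hC : ∀ x, ‖F x‖ ≤ C) : eLpNorm F p μ ≤ ENNReal.ofReal C := by
  refine (eLpNorm_le_of_ae_bound (Eventually.of_forall hC)).trans ?_
  simp [measure_univ]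

end L2Tools

section TestFieldBounds

/-! ## Uniform bounds for smooth test fields with compact support in time -/

variable {θ : ℝ} {ψ : ℝ → UnitAddTorus d → EuclideanSpace ℝ d} {a b : ℝ}

omit [DecidableEq d] in
/-- `sup_{t,x} ‖∂ₜψ‖ < ∞` for a smooth test field supported in `[a, b]` in time. [folklore] -/
theorem exists_bound_timeDeriv (hψ : ContDiff ℝ ∞ (stLift ψ)) (hab : ∀ t, t ∉ Icc a b → ψ t = 0) :
    ∃ K : ℝ, 0 ≤ K ∧ ∀ t x, ‖timeDeriv ψ t x‖ ≤ K := by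
  have hψI : IsSmoothSpaceTimeOn univ ψ := hψ.contDiffOn
  have hψ'I : IsSmoothSpaceTimeOn univ (timeDeriv ψ) := by
    have h1 := hψI.timeDerivWithin uniqueDiffOn_univ
    rwa [timeDerivWithin_univ] at h1
  obtain ⟨C, hC⟩ := hψ'I.exists_norm_le_of_isCompact isCompact_Icc (subset_univ (Icc a b))
  refine ⟨max C 0, le_max_right _ _, fun t x => ?_⟩
  by_cases ht : t ∈ Icc a b
  · exact (hC t ht x).trans (le_max_left _ _)
  · rw [timeDeriv_eq_zero_of_forall_not_mem_Icc hab ht x, norm_zero]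
    exact le_max_right _ _

/-- `sup_{t,x,j} ‖∂ⱼψ‖ < ∞` for a smooth test field supported in `[a, b]` in time. [folklore] -/
theorem exists_bound_partialDeriv (hψ : ContDiff ℝ ∞ (stLift ψ))
    (hab : ∀ t, t ∉ Icc a b → ψ t = 0) :
    ∃ K : ℝ, 0 ≤ K ∧ ∀ t x j, ‖partialDeriv j (ψ t) x‖ ≤ K := by
  have hψI : IsSmoothSpaceTimeOn univ ψ := hψ.contDiffOn
  have hj : ∀ j : d, ∃ C : ℝ, ∀ t ∈ Icc a b, ∀ x, ‖partialDeriv j (ψ t) x‖ ≤ C := fun j =>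
    (hψI.partialDeriv uniqueDiffOn_univ j).exists_norm_le_of_isCompact isCompact_Icc
      (subset_univ (Icc a b))
  choose C hC using hj
  refine ⟨∑ j, max (C j) 0, Finset.sum_nonneg fun j _ => le_max_right _ _, fun t x j => ?_⟩
  have hle : max (C j) 0 ≤ ∑ i, max (C i) 0 :=
    Finset.single_le_sum (f := fun i => max (C i) 0) (fun i _ => le_max_right _ _) (Finset.mem_univ j)
  by_cases ht : t ∈ Icc a b
  · exact ((hC j t ht x).trans (le_max_left _ _)).trans hle
  · rw [partialDeriv_slice_eq_zero_of_forall_not_mem_Icc hab ht j x, norm_zero]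
    exact (le_max_right _ _).trans hle

/-- `sup_{t,x} ‖(-Δ)^θ ψ‖ < ∞` (`θ ≥ 0`) for a smooth test field supported in `[a, b]` in time. [folklore] -/
theorem exists_bound_fracLaplacian (hθ : 0 ≤ θ) (hψ : ContDiff ℝ ∞ (stLift ψ))
    (hab : ∀ t, t ∉ Icc a b → ψ t = 0) :
    ∃ K : ℝ, 0 ≤ K ∧ ∀ t x, ‖fracLaplacian θ (ψ t) x‖ ≤ K := by
  have hψI : IsSmoothSpaceTimeOn univ ψ := hψ.contDiffOn
  obtain ⟨M, hM0, hM⟩ := exists_norm_fracLaplacian_le hθ hψI (isCompact_Icc (a := a) (b := b))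
  refine ⟨M, hM0, fun t x => ?_⟩
  by_cases ht : t ∈ Icc a b
  · exact hM t ht x
  · rw [hab t ht, congrFun (fracLaplacian_zero_fun θ) x, Pi.zero_apply, norm_zero]
    exact hM0

end TestFieldBounds

section WeakIntegrand

/-! ## The weak integrand and its stability in `L²` -/

variable {ν θ : ℝ}

omit [DecidableEq d] in
/-- Pointwise stability of the full weak integrand
`⟪a, P⟫ + ⟪a, ∑ᵢ aᵢ Dᵢ⟫ - ν⟪a, L⟫` in `a`. [folklore] -/
theorem abs_fullIntegrand_sub_le (a b P L : EuclideanSpace ℝ d) (D : d → EuclideanSpace ℝ d)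
    {K₁ K₂ K₃ : ℝ} (hP : ‖P‖ ≤ K₁) (hD : ∀ i, ‖D i‖ ≤ K₂) (hL : ‖L‖ ≤ K₃) :
    |(⟪a, P⟫_ℝ + ⟪a, ∑ i, a i • D i⟫_ℝ - ν * ⟪a, L⟫_ℝ) -
        (⟪b, P⟫_ℝ + ⟪b, ∑ i, b i • D i⟫_ℝ - ν * ⟪b, L⟫_ℝ)| ≤
      ‖a - b‖ * (K₁ + |ν| * K₃ + Fintype.card d * K₂ * (‖a‖ + ‖b‖)) := by
  have h1 := abs_weakIntegrand_sub_le a b P D hP hD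
  have h2 : |ν * ⟪a, L⟫_ℝ - ν * ⟪b, L⟫_ℝ| ≤ |ν| * (‖a - b‖ * K₃) := by
    rw [← mul_sub, abs_mul, ← inner_sub_left]
    exact mul_le_mul_of_nonneg_left
      ((abs_real_inner_le_norm _ _).trans (mul_le_mul_of_nonneg_left hL (norm_nonneg _)))
      (abs_nonneg ν)
  have e : (⟪a, P⟫_ℝ + ⟪a, ∑ i, a i • D i⟫_ℝ - ν * ⟪a, L⟫_ℝ) -
        (⟪b, P⟫_ℝ + ⟪b, ∑ i, b i • D i⟫_ℝ - ν * ⟪b, L⟫_ℝ) =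
      ((⟪a, P⟫_ℝ + ⟪a, ∑ i, a i • D i⟫_ℝ) - (⟪b, P⟫_ℝ + ⟪b, ∑ i, b i • D i⟫_ℝ)) -
        (ν * ⟪a, L⟫_ℝ - ν * ⟪b, L⟫_ℝ) := by ring
  rw [e]
  calc |((⟪a, P⟫_ℝ + ⟪a, ∑ i, a i • D i⟫_ℝ) - (⟪b, P⟫_ℝ + ⟪b, ∑ i, b i • D i⟫_ℝ)) -
        (ν * ⟪a, L⟫_ℝ - ν * ⟪b, L⟫_ℝ)|
      ≤ |(⟪a, P⟫_ℝ + ⟪a, ∑ i, a i • D i⟫_ℝ) - (⟪b, P⟫_ℝ + ⟪b, ∑ i, b i • D i⟫_ℝ)| +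
          |ν * ⟪a, L⟫_ℝ - ν * ⟪b, L⟫_ℝ| := abs_sub _ _
    _ ≤ ‖a - b‖ * (K₁ + Fintype.card d * K₂ * (‖a‖ + ‖b‖)) + |ν| * (‖a - b‖ * K₃) :=
        add_le_add h1 h2
    _ = ‖a - b‖ * (K₁ + |ν| * K₃ + Fintype.card d * K₂ * (‖a‖ + ‖b‖)) := by ring

omit [DecidableEq d] in
/-- The size of the weak integrand at `a`: `|⟪a,P⟫ + ⟪a, ∑ aᵢDᵢ⟫ - ν⟪a,L⟫| ≤
‖a‖ (K₁ + |ν| K₃ + card d · K₂ ‖a‖)` (the case `b = 0`). [folklore] -/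
theorem abs_fullIntegrand_le (a P L : EuclideanSpace ℝ d) (D : d → EuclideanSpace ℝ d)
    {K₁ K₂ K₃ : ℝ} (hP : ‖P‖ ≤ K₁) (hD : ∀ i, ‖D i‖ ≤ K₂) (hL : ‖L‖ ≤ K₃) :
    |⟪a, P⟫_ℝ + ⟪a, ∑ i, a i • D i⟫_ℝ - ν * ⟪a, L⟫_ℝ| ≤
      ‖a‖ * (K₁ + |ν| * K₃ + Fintype.card d * K₂ * ‖a‖) := by
  have h := abs_fullIntegrand_sub_le (ν := ν) a 0 P L D hP hD hL
  simpa using h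

variable {X : Type*} [MeasurableSpace X] {μ : Measure X}

omit [DecidableEq d] in
/-- Measurability of the weak integrand for an a.e.-strongly measurable field and continuous
coefficients. [folklore] -/
theorem aestronglyMeasurable_fullIntegrand {f : X → EuclideanSpace ℝ d}
    (hf : AEStronglyMeasurable f μ) {P L : X → EuclideanSpace ℝ d} {D : X → d → EuclideanSpace ℝ d}
    (hP : AEStronglyMeasurable P μ) (hD : ∀ i, AEStronglyMeasurable (fun x => D x i) μ)
    (hL : AEStronglyMeasurable L μ) :
    AEStronglyMeasurable (fun x => ⟪f x, P x⟫_ℝ + ⟪f x, ∑ i, f x i • D x i⟫_ℝ -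
      ν * ⟪f x, L x⟫_ℝ) μ := by
  have hfi : ∀ i, AEStronglyMeasurable (fun x => f x i) μ := fun i =>
    (EuclideanSpace.proj i).continuous.comp_aestronglyMeasurable hf
  have hS : AEStronglyMeasurable (fun x => ∑ i, f x i • D x i) μ := by
    have h : (fun x => ∑ i, f x i • D x i) = ∑ i, fun x => f x i • D x i := by
      funext x; simp
    rw [h]
    exact Finset.aestronglyMeasurable_sum _ fun i _ => (hfi i).smul (hD i)
  exact ((hf.inner hP).add (hf.inner hS)).sub ((hf.inner hL).const_mul ν)

omit [DecidableEq d] in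
/-- **Integrability of the weak integrand for `L²` fields** with bounded continuous coefficients
(dominated by `‖f‖(K₁ + |ν|K₃) + card d · K₂ ‖f‖²`). [folklore] -/
theorem integrable_fullIntegrand [IsFiniteMeasure μ] {f : X → EuclideanSpace ℝ d}
    (hf : MemLp f 2 μ) {P L : X → EuclideanSpace ℝ d} {D : X → d → EuclideanSpace ℝ d}
    (hP : AEStronglyMeasurable P μ) (hD : ∀ i, AEStronglyMeasurable (fun x => D x i) μ)
    (hL : AEStronglyMeasurable L μ) {K₁ K₂ K₃ : ℝ} (hPb : ∀ x, ‖P x‖ ≤ K₁)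
    (hDb : ∀ x i, ‖D x i‖ ≤ K₂) (hLb : ∀ x, ‖L x‖ ≤ K₃) :
    Integrable (fun x => ⟪f x, P x⟫_ℝ + ⟪f x, ∑ i, f x i • D x i⟫_ℝ - ν * ⟪f x, L x⟫_ℝ) μ := by
  have hn : Integrable (fun x => ‖f x‖) μ := (hf.integrable one_le_two).norm
  have hn2 : Integrable (fun x => ‖f x‖ ^ 2) μ := (memLp_two_iff_integrable_sq_norm hf.1).1 hf
  have hbound : Integrable (fun x => ‖f x‖ * (K₁ + |ν| * K₃) + Fintype.card d * K₂ * ‖f x‖ ^ 2) μ :=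
    (hn.mul_const _).add (hn2.const_mul _)
  refine hbound.mono' (aestronglyMeasurable_fullIntegrand hf.1 hP hD hL) (ae_of_all _ fun x => ?_)
  rw [Real.norm_eq_abs]
  calc |⟪f x, P x⟫_ℝ + ⟪f x, ∑ i, f x i • D x i⟫_ℝ - ν * ⟪f x, L x⟫_ℝ|
      ≤ ‖f x‖ * (K₁ + |ν| * K₃ + Fintype.card d * K₂ * ‖f x‖) :=
        abs_fullIntegrand_le (f x) (P x) (L x) (D x) (hPb x) (hDb x) (hLb x)
    _ = ‖f x‖ * (K₁ + |ν| * K₃) + Fintype.card d * K₂ * ‖f x‖ ^ 2 := by ring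

omit [DecidableEq d] in
/-- **`L²`-stability of the weak functional.** For `L²` fields `f, g` and bounded continuous
coefficients,
`‖∫ I(f) - ∫ I(g)‖ₑ ≤ (K₁ + |ν|K₃) ‖f - g‖₂ + card d · K₂ ‖f - g‖₂ (‖f‖₂ + ‖g‖₂)`
(Cauchy–Schwarz; on a probability space `‖·‖₁ ≤ ‖·‖₂`). [folklore] -/
theorem enorm_integral_fullIntegrand_sub_le [IsProbabilityMeasure μ] {f g : X → EuclideanSpace ℝ d}
    (hf : MemLp f 2 μ) (hg : MemLp g 2 μ) {P L : X → EuclideanSpace ℝ d}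
    {D : X → d → EuclideanSpace ℝ d} (hP : AEStronglyMeasurable P μ)
    (hD : ∀ i, AEStronglyMeasurable (fun x => D x i) μ) (hL : AEStronglyMeasurable L μ)
    {K₁ K₂ K₃ : ℝ} (hK₁ : 0 ≤ K₁) (hK₂ : 0 ≤ K₂) (hK₃ : 0 ≤ K₃) (hPb : ∀ x, ‖P x‖ ≤ K₁)
    (hDb : ∀ x i, ‖D x i‖ ≤ K₂) (hLb : ∀ x, ‖L x‖ ≤ K₃) :
    ‖(∫ x, (⟪f x, P x⟫_ℝ + ⟪f x, ∑ i, f x i • D x i⟫_ℝ - ν * ⟪f x, L x⟫_ℝ) ∂μ) -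
        ∫ x, (⟪g x, P x⟫_ℝ + ⟪g x, ∑ i, g x i • D x i⟫_ℝ - ν * ⟪g x, L x⟫_ℝ) ∂μ‖ₑ ≤
      ENNReal.ofReal (K₁ + |ν| * K₃) * eLpNorm (f - g) 2 μ +
        ENNReal.ofReal (Fintype.card d * K₂) * (eLpNorm (f - g) 2 μ * (eLpNorm f 2 μ + eLpNorm g 2 μ)) := by
  have hIf := integrable_fullIntegrand (ν := ν) hf hP hD hL hPb hDb hLb
  have hIg := integrable_fullIntegrand (ν := ν) hg hP hD hL hPb hDb hLb
  rw [← integral_sub hIf hIg]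
  refine (enorm_integral_le_lintegral_enorm _).trans ?_
  -- pointwise bound
  have hpt : ∀ x, ‖(⟪f x, P x⟫_ℝ + ⟪f x, ∑ i, f x i • D x i⟫_ℝ - ν * ⟪f x, L x⟫_ℝ) -
      (⟪g x, P x⟫_ℝ + ⟪g x, ∑ i, g x i • D x i⟫_ℝ - ν * ⟪g x, L x⟫_ℝ)‖ₑ ≤
      ‖f x - g x‖ₑ * ENNReal.ofReal (K₁ + |ν| * K₃) +
        ENNReal.ofReal (Fintype.card d * K₂) * (‖f x - g x‖ₑ * ‖f x‖ₑ + ‖f x - g x‖ₑ * ‖g x‖ₑ) := by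
    intro x
    have h := abs_fullIntegrand_sub_le (ν := ν) (f x) (g x) (P x) (L x) (D x) (hPb x) (hDb x) (hLb x)
    rw [← Real.norm_eq_abs] at h
    rw [← ofReal_norm, ← ofReal_norm, ← ofReal_norm, ← ofReal_norm]
    have hc : 0 ≤ (Fintype.card d : ℝ) * K₂ := mul_nonneg (Nat.cast_nonneg _) hK₂
    have hK : 0 ≤ K₁ + |ν| * K₃ := add_nonneg hK₁ (mul_nonneg (abs_nonneg ν) hK₃)
    rw [← ENNReal.ofReal_mul (norm_nonneg _), ← ENNReal.ofReal_mul (norm_nonneg _),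
      ← ENNReal.ofReal_mul (norm_nonneg _), ← ENNReal.ofReal_add (by positivity) (by positivity),
      ← ENNReal.ofReal_mul hc, ← ENNReal.ofReal_add (by positivity) (by positivity)]
    refine ENNReal.ofReal_le_ofReal (h.trans (le_of_eq ?_))
    ring
  refine (lintegral_mono hpt).trans ?_
  have hfg : AEStronglyMeasurable (f - g) μ := hf.1.sub hg.1
  have hm1 : AEMeasurable (fun x => ‖f x - g x‖ₑ) μ := hfg.enorm
  have hm2 : AEMeasurable (fun x => ‖f x - g x‖ₑ * ‖f x‖ₑ) μ := hm1.mul hf.1.enorm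
  have hm3 : AEMeasurable (fun x => ‖f x - g x‖ₑ * ‖g x‖ₑ) μ := hm1.mul hg.1.enorm
  have hm23 : AEMeasurable (fun x => ‖f x - g x‖ₑ * ‖f x‖ₑ + ‖f x - g x‖ₑ * ‖g x‖ₑ) μ :=
    hm2.add hm3
  rw [lintegral_add_left' (hm1.mul_const _), lintegral_mul_const'' _ hm1,
    lintegral_const_mul'' _ hm23, lintegral_add_left' hm2]
  have h1 : ∫⁻ x, ‖f x - g x‖ₑ ∂μ ≤ eLpNorm (f - g) 2 μ := lintegral_enorm_le_eLpNorm_two hfg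
  have h2 : ∫⁻ x, ‖f x - g x‖ₑ * ‖f x‖ₑ ∂μ ≤ eLpNorm (f - g) 2 μ * eLpNorm f 2 μ :=
    lintegral_enorm_mul_enorm_le hfg hf.1
  have h3 : ∫⁻ x, ‖f x - g x‖ₑ * ‖g x‖ₑ ∂μ ≤ eLpNorm (f - g) 2 μ * eLpNorm g 2 μ :=
    lintegral_enorm_mul_enorm_le hfg hg.1
  calc (∫⁻ x, ‖f x - g x‖ₑ ∂μ) * ENNReal.ofReal (K₁ + |ν| * K₃) +
        ENNReal.ofReal (Fintype.card d * K₂) *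
          ((∫⁻ x, ‖f x - g x‖ₑ * ‖f x‖ₑ ∂μ) + ∫⁻ x, ‖f x - g x‖ₑ * ‖g x‖ₑ ∂μ)
      ≤ eLpNorm (f - g) 2 μ * ENNReal.ofReal (K₁ + |ν| * K₃) +
          ENNReal.ofReal (Fintype.card d * K₂) *
            (eLpNorm (f - g) 2 μ * eLpNorm f 2 μ + eLpNorm (f - g) 2 μ * eLpNorm g 2 μ) := by
        gcongr
    _ = ENNReal.ofReal (K₁ + |ν| * K₃) * eLpNorm (f - g) 2 μ +
          ENNReal.ofReal (Fintype.card d * K₂) *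
            (eLpNorm (f - g) 2 μ * (eLpNorm f 2 μ + eLpNorm g 2 μ)) := by
        rw [mul_comm, mul_add (eLpNorm (f - g) 2 μ)]

omit [DecidableEq d] in
/-- **The Reynolds defect is controlled by `‖R‖_{L¹}`**: if `‖∂ⱼψ‖ ≤ K` then
`‖∫ ∑ⱼ ⟪R^{(j)}, ∂ⱼψ⟫‖ ≤ card d · K · ∫ ‖R‖`. [folklore] -/
theorem norm_integral_defect_le_integral_norm {Rt : UnitAddTorus d → d → EuclideanSpace ℝ d}
    (hRt : Continuous Rt) {D : UnitAddTorus d → d → EuclideanSpace ℝ d} (hDc : Continuous D)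
    {K : ℝ} (hD : ∀ x j, ‖D x j‖ ≤ K) :
    ‖∫ x, ∑ j, ⟪Rt x j, D x j⟫_ℝ‖ ≤ Fintype.card d * K * ∫ x, ‖Rt x‖ := by
  have hpt : ∀ x, ‖∑ j, ⟪Rt x j, D x j⟫_ℝ‖ ≤ Fintype.card d * K * ‖Rt x‖ := by
    intro x
    calc ‖∑ j, ⟪Rt x j, D x j⟫_ℝ‖ ≤ ∑ j, ‖⟪Rt x j, D x j⟫_ℝ‖ := norm_sum_le _ _
      _ ≤ ∑ _j : d, ‖Rt x‖ * K := Finset.sum_le_sum fun j _ => by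
          calc ‖⟪Rt x j, D x j⟫_ℝ‖ ≤ ‖Rt x j‖ * ‖D x j‖ := norm_inner_le_norm _ _
            _ ≤ ‖Rt x‖ * K :=
              mul_le_mul (norm_le_pi_norm (Rt x) j) (hD x j) (norm_nonneg _) (norm_nonneg _)
      _ = Fintype.card d * K * ‖Rt x‖ := by simp; ring
  have hci : Continuous fun x => ∑ j, ⟪Rt x j, D x j⟫_ℝ :=
    continuous_finsetSum _ fun j _ =>
      ((continuous_apply j).comp hRt).inner ((continuous_apply j).comp hDc)
  calc ‖∫ x, ∑ j, ⟪Rt x j, D x j⟫_ℝ‖ ≤ ∫ x, ‖∑ j, ⟪Rt x j, D x j⟫_ℝ‖ :=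
        norm_integral_le_integral_norm _
    _ ≤ ∫ x, Fintype.card d * K * ‖Rt x‖ :=
        integral_mono hci.norm.integrable_unitAddTorus
          (hRt.norm.integrable_unitAddTorus.const_mul _) hpt
    _ = Fintype.card d * K * ∫ x, ‖Rt x‖ := integral_const_mul _ _

end WeakIntegrand

section WeakContinuity

/-! ## Weak continuity in time -/

variable {V : Type*} [NormedAddCommGroup V] [InnerProductSpace ℝ V]

/-- `⟪f, g⟫ ∈ L¹` for `f, g ∈ L²`. [folklore] -/
theorem integrable_real_inner_of_memLp {X : Type*} [MeasurableSpace X] {μ : Measure X}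
    {f g : X → V} (hf : MemLp f 2 μ) (hg : MemLp g 2 μ) :
    Integrable (fun x => ⟪f x, g x⟫_ℝ) μ :=
  (hf.norm.integrable_mul hg.norm).mono' (hf.1.inner hg.1)
    (ae_of_all _ fun x => norm_inner_le_norm (f x) (g x))

omit [DecidableEq d] in
/-- For a bounded, jointly continuous space–time field `u` and `φ ∈ L²(T^d)`, the pairing
`t ↦ ∫ ⟪u(t), φ⟫` is continuous (dominated convergence). [folklore] -/
theorem continuous_integral_inner_of_bound [CompleteSpace V] [SecondCountableTopology V]
    {u : ℝ → UnitAddTorus d → V}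
    (hu : Continuous (Function.uncurry u)) {C : ℝ} (hC : ∀ t x, ‖u t x‖ ≤ C) {φ : UnitAddTorus d → V}
    (hφ : MemLp φ 2 volume) : Continuous fun t => ∫ x, ⟪u t x, φ x⟫_ℝ := by
  have hut : ∀ t, Continuous (u t) := fun t => hu.comp (continuous_const.prodMk continuous_id)
  refine continuous_of_dominated (bound := fun x => C * ‖φ x‖) (fun t => ?_) (fun t => ?_) ?_ ?_
  · exact (hut t).aestronglyMeasurable.inner hφ.1
  · exact ae_of_all _ fun x => (norm_inner_le_norm _ _).trans
      (mul_le_mul_of_nonneg_right (hC t x) (norm_nonneg _))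
  · exact (hφ.integrable one_le_two).norm.const_mul C
  · exact ae_of_all _ fun x =>
      ((hu.comp (continuous_id.prodMk continuous_const)).inner continuous_const)

omit [DecidableEq d] in
/-- **Uniform `L²` limits preserve continuity of pairings**: if `t ↦ ∫ ⟪v_q(t), φ⟫` is
continuous for every `q` and `sup_t ‖w(t) - v_q(t)‖_{L²} → 0`, then `t ↦ ∫ ⟪w(t), φ⟫` is
continuous for `φ ∈ L²`. [folklore] -/
theorem continuous_integral_inner_of_unifL2 {w : ℝ → UnitAddTorus d → V}
    {v : ℕ → ℝ → UnitAddTorus d → V} {φ : UnitAddTorus d → V} (hφ : MemLp φ 2 volume)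
    (hv : ∀ q, Continuous fun t => ∫ x, ⟪v q t x, φ x⟫_ℝ) (hw : ∀ t, MemLp (w t) 2 volume)
    (hvm : ∀ q t, MemLp (v q t) 2 volume)
    (hT : ∀ ε : ℝ≥0∞, 0 < ε → ∃ N, ∀ q ≥ N, ∀ t, eLpNorm (w t - v q t) 2 volume ≤ ε) :
    Continuous fun t => ∫ x, ⟪w t x, φ x⟫_ℝ := by
  refine TendstoUniformly.continuous (F := fun q t => ∫ x, ⟪v q t x, φ x⟫_ℝ) (p := atTop) ?_
    (Eventually.of_forall hv).frequently
  rw [Metric.tendstoUniformly_iff]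
  intro ε hε
  have hφfin : eLpNorm φ 2 volume < ⊤ := hφ.eLpNorm_lt_top
  set Φ : ℝ := (eLpNorm φ 2 volume).toReal with hΦ_def
  have hΦ : 0 ≤ Φ := ENNReal.toReal_nonneg
  obtain ⟨N, hN⟩ := hT (ENNReal.ofReal (ε / (2 * (Φ + 1)))) (ENNReal.ofReal_pos.2 (by positivity))
  refine eventually_atTop.2 ⟨N, fun q hq t => ?_⟩
  have i1 : Integrable (fun x => ⟪w t x, φ x⟫_ℝ) volume := integrable_real_inner_of_memLp (hw t) hφ
  have i2 : Integrable (fun x => ⟪v q t x, φ x⟫_ℝ) volume :=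
    integrable_real_inner_of_memLp (hvm q t) hφ
  have hsub : (∫ x, ⟪w t x, φ x⟫_ℝ) - ∫ x, ⟪v q t x, φ x⟫_ℝ = ∫ x, ⟪(w t - v q t) x, φ x⟫_ℝ := by
    rw [← integral_sub i1 i2]
    refine integral_congr_ae (ae_of_all _ fun x => ?_)
    simp only [Pi.sub_apply, inner_sub_left]
  rw [dist_eq_norm, hsub]
  have hfin : eLpNorm (w t - v q t) 2 volume * eLpNorm φ 2 volume ≠ ⊤ :=
    ENNReal.mul_ne_top ((hw t).sub (hvm q t)).eLpNorm_ne_top hφfin.ne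
  calc ‖∫ x, ⟪(w t - v q t) x, φ x⟫_ℝ‖
      ≤ (eLpNorm (w t - v q t) 2 volume * eLpNorm φ 2 volume).toReal :=
        norm_integral_inner_le_toReal ((hw t).sub (hvm q t)).1 hφ.1 hfin
    _ ≤ (ENNReal.ofReal (ε / (2 * (Φ + 1))) * eLpNorm φ 2 volume).toReal :=
        ENNReal.toReal_mono (ENNReal.mul_ne_top ENNReal.ofReal_ne_top hφfin.ne)
          (mul_le_mul' (hN q hq t) le_rfl)
    _ = ε / (2 * (Φ + 1)) * Φ := by
        rw [ENNReal.toReal_mul, ENNReal.toReal_ofReal (by positivity)]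
    _ < ε := by
        have h1 : ε / (2 * (Φ + 1)) * Φ ≤ ε / (2 * (Φ + 1)) * (Φ + 1) :=
          mul_le_mul_of_nonneg_left (by linarith) (by positivity)
        have h2 : ε / (2 * (Φ + 1)) * (Φ + 1) = ε / 2 := by
          field_simp
        linarith

end WeakContinuity

section LimitTheorem

/-! ## `C⁰_t L²_x` limits of fractional Navier–Stokes–Reynolds flows with vanishing stress -/

variable {θ ν : ℝ}

/-- **Continuity in time of the weak functional of a smooth field**: for `u` smooth on
`ℝ × T^d`, `θ ≥ 0` and a smooth test field `ψ`,
`t ↦ ∫ (⟪u, ∂ₜψ⟫ + ⟪u, (u·∇)ψ⟫ - ν⟪u, (-Δ)^θ ψ⟫)(t, x) dx` is continuous. [folklore] -/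
theorem continuous_weakFunctional (hθ : 0 ≤ θ) {u : ℝ → UnitAddTorus d → EuclideanSpace ℝ d}
    (hu : IsSmoothSpaceTimeOn univ u) {ψ : ℝ → UnitAddTorus d → EuclideanSpace ℝ d}
    (hψ : ContDiff ℝ ∞ (stLift ψ)) :
    Continuous fun t => ∫ x, (⟪u t x, timeDeriv ψ t x⟫_ℝ + ⟪u t x, convect (u t) (ψ t) x⟫_ℝ -
      ν * ⟪u t x, fracLaplacian θ (ψ t) x⟫_ℝ) := by
  have hU : UniqueDiffOn ℝ (univ : Set ℝ) := uniqueDiffOn_univ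
  have hψI : IsSmoothSpaceTimeOn univ ψ := hψ.contDiffOn
  have hψ'I : IsSmoothSpaceTimeOn univ (timeDeriv ψ) := by
    have h1 := hψI.timeDerivWithin hU
    rwa [timeDerivWithin_univ] at h1
  have h12 : IsSmoothSpaceTimeOn univ
      (fun t x => ⟪u t x, timeDeriv ψ t x⟫_ℝ + ⟪u t x, convect (u t) (ψ t) x⟫_ℝ) :=
    (hu.inner hψ'I).add (hu.inner (hu.convect hψI hU))
  have hΛ : ContinuousOn (stLift fun t => fracLaplacian θ (ψ t)) (univ ×ˢ univ) :=
    (continuous_stLift_fracLaplacian hθ hψI).continuousOn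
  have hc3 : ContinuousOn (stLift fun t x => ν * ⟪u t x, fracLaplacian θ (ψ t) x⟫_ℝ) (univ ×ˢ univ) :=
    (continuous_const.mul continuous_inner).comp_continuousOn (hu.continuousOn_stLift.prodMk hΛ)
  have hc : ContinuousOn (stLift fun t x =>
      ⟪u t x, timeDeriv ψ t x⟫_ℝ + ⟪u t x, convect (u t) (ψ t) x⟫_ℝ -
        ν * ⟪u t x, fracLaplacian θ (ψ t) x⟫_ℝ) (univ ×ˢ univ) := h12.continuousOn_stLift.sub hc3
  exact continuousOn_univ.1 (continuousOn_integral_of_continuousOn_stLift hc)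

omit [DecidableEq d] in
/-- Fields smooth on `ℝ × T^d` are jointly continuous on `ℝ × T^d`. [folklore] -/
theorem continuous_uncurry_of_isSmoothSpaceTimeOn {F : Type*} [NormedAddCommGroup F]
    [NormedSpace ℝ F] {u : ℝ → UnitAddTorus d → F} (hu : IsSmoothSpaceTimeOn univ u) :
    Continuous (Function.uncurry u) := by
  have h : Continuous (stLift u) := by
    rw [← continuousOn_univ, ← univ_prod_univ]
    exact hu.continuousOn_stLift
  exact continuous_uncurry_of_continuous_stLift h

omit [Fintype d] [DecidableEq d] in
/-- A jointly continuous field vanishing off a bounded time interval is bounded. [folklore] -/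
theorem exists_bound_of_continuous_of_support {F : Type*} [NormedAddCommGroup F]
    [NormedSpace ℝ F] {u : ℝ → UnitAddTorus d → F} (hu : Continuous (Function.uncurry u))
    {a b : ℝ} (hab : ∀ t, t ∉ Ioo a b → u t = 0) : ∃ C : ℝ, 0 ≤ C ∧ ∀ t x, ‖u t x‖ ≤ C := by
  have hst : Continuous (stLift u) := hu.comp (continuous_id.prodMap continuous_proj)
  obtain ⟨C, hC⟩ := exists_norm_le_of_continuousOn_of_isCompact (S := univ) hst.continuousOn
    isCompact_Icc (subset_univ (Icc a b))
  refine ⟨max C 0, le_max_right _ _, fun t x => ?_⟩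
  by_cases ht : t ∈ Ioo a b
  · exact (hC t (Ioo_subset_Icc_self ht) x).trans (le_max_left _ _)
  · rw [hab t ht]
    simp

omit [DecidableEq d] in
/-- **Uniform `L²` bookkeeping for the limit field.** For jointly continuous fields `v_q`
vanishing off `(a, b)` (at least `v₀`) with `sup_t ‖v_{q+1}(t) - v_q(t)‖_{L²} ≤ β_q`, `∑ β_q < ∞`:
the slices of `w = stLim v` are measurable and in `L²`, `‖v_q(t)‖_{L²}, ‖w(t)‖_{L²} ≤ M < ∞`
uniformly, and `sup_t ‖w(t) - v_q(t)‖_{L²} → 0`. [folklore] -/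
theorem stLim_L2_facts {v : ℕ → ℝ → UnitAddTorus d → EuclideanSpace ℝ d}
    (hcont : ∀ q, Continuous (Function.uncurry (v q))) {a b : ℝ}
    (hsupp0 : ∀ t, t ∉ Ioo a b → v 0 t = 0) {β : ℕ → ℝ≥0∞}
    (hβ : ∀ q t, eLpNorm (v (q + 1) t - v q t) 2 volume ≤ β q) (hβs : ∑' q, β q ≠ ⊤) :
    ∃ M : ℝ≥0∞, M ≠ ⊤ ∧ (∀ t, AEStronglyMeasurable (stLim v t) volume) ∧
      (∀ q t, MemLp (v q t) 2 volume) ∧ (∀ t, MemLp (stLim v t) 2 volume) ∧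
      (∀ q t, eLpNorm (v q t) 2 volume ≤ M) ∧ (∀ t, eLpNorm (stLim v t) 2 volume ≤ M) ∧
      (∀ t, ∀ᵐ x, Tendsto (fun q => v q t x) atTop (𝓝 (stLim v t x))) ∧
      ∀ ε : ℝ≥0∞, 0 < ε → ∃ N, ∀ q ≥ N, ∀ t, eLpNorm (stLim v t - v q t) 2 volume ≤ ε := by
  borelize (EuclideanSpace ℝ d)
  have hvc : ∀ q t, Continuous (v q t) := fun q t => (hcont q).comp (continuous_const.prodMk continuous_id)
  have hvm : ∀ q t, AEStronglyMeasurable (v q t) volume := fun q t => (hvc q t).aestronglyMeasurable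
  have hvL2 : ∀ q t, MemLp (v q t) 2 volume := fun q t =>
    (hvc q t).memLp_of_hasCompactSupport (HasCompactSupport.of_compactSpace _)
  set w := stLim v with hw_def
  have hlim : ∀ t, ∀ᵐ x, Tendsto (fun q => v q t x) atTop (𝓝 (w t x)) :=
    ae_tendsto_stLim hvm hβ hβs
  have hwm : ∀ t, AEStronglyMeasurable (w t) volume := fun t =>
    aestronglyMeasurable_of_tendsto_ae atTop (fun q => hvm q t) (hlim t)
  set T : ℕ → ℝ≥0∞ := fun q => ∑' k, β (q + k) with hT_def
  have hT : ∀ q t, eLpNorm (w t - v q t) 2 volume ≤ T q := fun q t =>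
    eLpNorm_lim_sub_le (fun q => hvm q t) (hlim t) one_le_two (fun q => hβ q t) q
  have hT0 : ∀ ε : ℝ≥0∞, 0 < ε → ∃ N, ∀ q ≥ N, ∀ t, eLpNorm (w t - v q t) 2 volume ≤ ε := by
    intro ε hε
    obtain ⟨N, hN⟩ := exists_tsum_add_le hβs hε
    exact ⟨N, fun q hq t => (hT q t).trans (hN q hq)⟩
  obtain ⟨C₀, -, hC₀⟩ := exists_bound_of_continuous_of_support (hcont 0) hsupp0
  set M : ℝ≥0∞ := ENNReal.ofReal C₀ + ∑' k, β k with hM_def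
  have hMtop : M ≠ ⊤ := ENNReal.add_ne_top.2 ⟨ENNReal.ofReal_ne_top, hβs⟩
  have hv0 : ∀ t, eLpNorm (v 0 t) 2 volume ≤ ENNReal.ofReal C₀ := fun t =>
    eLpNorm_le_of_bound 2 (hC₀ t)
  have hMv : ∀ q t, eLpNorm (v q t) 2 volume ≤ M := by
    intro q t
    have h1 : eLpNorm (v (0 + q) t - v 0 t) 2 volume ≤ ∑' k, β (0 + k) :=
      eLpNorm_sub_le_tsum (fun q => hvm q t) one_le_two (fun q => hβ q t) 0 q
    simp only [zero_add] at h1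
    calc eLpNorm (v q t) 2 volume = eLpNorm (v 0 t + (v q t - v 0 t)) 2 volume := by
          congr 1; abel
      _ ≤ eLpNorm (v 0 t) 2 volume + eLpNorm (v q t - v 0 t) 2 volume :=
          eLpNorm_add_le (hvm 0 t) ((hvm q t).sub (hvm 0 t)) one_le_two
      _ ≤ M := add_le_add (hv0 t) h1
  have hMw : ∀ t, eLpNorm (w t) 2 volume ≤ M := by
    intro t
    have h1 : eLpNorm (w t - v 0 t) 2 volume ≤ ∑' k, β k := by
      have h := hT 0 t
      simpa only [hT_def, zero_add] using h
    calc eLpNorm (w t) 2 volume = eLpNorm (v 0 t + (w t - v 0 t)) 2 volume := by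
          congr 1; abel
      _ ≤ eLpNorm (v 0 t) 2 volume + eLpNorm (w t - v 0 t) 2 volume :=
          eLpNorm_add_le (hvm 0 t) ((hwm t).sub (hvm 0 t)) one_le_two
      _ ≤ M := add_le_add (hv0 t) h1
  have hwL2 : ∀ t, MemLp (w t) 2 volume := fun t =>
    ⟨hwm t, (hMw t).trans_lt (lt_top_iff_ne_top.2 hMtop)⟩
  exact ⟨M, hMtop, hwm, hvL2, hwL2, hMv, hMw, hlim, hT0⟩

/-- **The momentum identity passes to the `C⁰_t L²_x` limit** (Luo–Titi 2020, proof of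
Theorem 1, p. 4: "Since `‖R_{q+1}‖_{L^∞_t L¹_x} → 0`, as `q → ∞`, `v` is a weak solution"): under
the hypotheses of `isWeakFracNSSolutionLine_stLim`, the limit field satisfies the momentum
identity of `Torus.IsWeakFracNSSolutionLine` against every smooth divergence-free test field
with compact support in time. Ingredients: the weak identity with Reynolds defect for each
`v_q` (`IsFracNSReynoldsOn.weak_identity_line`), `‖defect‖ ≲ ‖R_q‖_{L^∞_t L¹_x} → 0`
(`norm_integral_defect_le_integral_norm`), and the `L²`-stability of the weak functional
(`enorm_integral_fullIntegrand_sub_le`), uniformly in time.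
[cite: LuoTiti2020, §2.1 proof of Theorem 1 (p. 4 of arXiv:1808.07595)] -/
theorem integral_weakFunctional_stLim_eq_zero (hθ : 0 ≤ θ)
    {v : ℕ → ℝ → UnitAddTorus d → EuclideanSpace ℝ d} {p : ℕ → ℝ → UnitAddTorus d → ℝ}
    {R : ℕ → ℝ → UnitAddTorus d → d → EuclideanSpace ℝ d}
    (hsol : ∀ q, IsFracNSReynoldsOn univ θ ν (v q) (p q) (R q))
    {a b : ℝ} (hsupp : ∀ q t, t ∉ Ioo a b → v q t = 0)
    {β : ℕ → ℝ≥0∞} (hβ : ∀ q t, eLpNorm (v (q + 1) t - v q t) 2 volume ≤ β q)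
    (hβs : ∑' q, β q ≠ ⊤)
    (hR : ∀ ε : ℝ, 0 < ε → ∃ N, ∀ q ≥ N, ∀ t, ∫ x, ‖R q t x‖ ≤ ε)
    {ψ : ℝ → UnitAddTorus d → EuclideanSpace ℝ d} (hψ : ContDiff ℝ ∞ (stLift ψ)) {a' b' : ℝ}
    (hab' : ∀ t, t ∉ Icc a' b' → ψ t = 0) (hψdiv : IsDivFreeTest ψ) :
    ∫ t, ∫ x, (⟪stLim v t x, timeDeriv ψ t x⟫_ℝ + ⟪stLim v t x, convect (stLim v t) (ψ t) x⟫_ℝ -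
      ν * ⟪stLim v t x, fracLaplacian θ (ψ t) x⟫_ℝ) = 0 := by
  have hcont : ∀ q, Continuous (Function.uncurry (v q)) := fun q =>
    continuous_uncurry_of_isSmoothSpaceTimeOn (hsol q).smooth_velocity
  obtain ⟨M, hMtop, hwm, hvL2, hwL2, hMv, hMw, -, hT0⟩ := stLim_L2_facts hcont (hsupp 0) hβ hβs
  set w := stLim v with hw_def
  have hsm : ∀ q t, IsSmooth (v q t) := fun q t =>
    (hsol q).smooth_velocity.isSmooth_slice (mem_univ t)
  have hRc : ∀ q t, Continuous (R q t) := fun q t =>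
    ((hsol q).smooth_stress.isSmooth_slice (mem_univ t)).continuous
  -- data of the test field
  obtain ⟨K₁, hK₁0, hK₁⟩ := exists_bound_timeDeriv hψ hab'
  obtain ⟨K₂, hK₂0, hK₂⟩ := exists_bound_partialDeriv hψ hab'
  obtain ⟨K₃, hK₃0, hK₃⟩ := exists_bound_fracLaplacian hθ hψ hab'
  have hψI : IsSmoothSpaceTimeOn univ ψ := hψ.contDiffOn
  have hψ'I : IsSmoothSpaceTimeOn univ (timeDeriv ψ) := by
    have h1 := hψI.timeDerivWithin uniqueDiffOn_univ
    rwa [timeDerivWithin_univ] at h1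
  have hψt : ∀ t, IsSmooth (ψ t) := fun t => hψI.isSmooth_slice (mem_univ t)
  have hPc : ∀ t, Continuous (timeDeriv ψ t) := fun t =>
    (hψ'I.isSmooth_slice (mem_univ t)).continuous
  have hDc : ∀ t i, Continuous (partialDeriv i (ψ t)) := fun t i =>
    ((hψt t).partialDeriv i).continuous
  have hDc' : ∀ t, Continuous fun x => fun j => partialDeriv j (ψ t) x := fun t =>
    continuous_pi fun j => hDc t j
  have hLc : ∀ t, Continuous (fracLaplacian θ (ψ t)) := fun t => continuous_fracLaplacian hθ (hψt t)
  have hconv : ∀ (f : UnitAddTorus d → EuclideanSpace ℝ d) (t : ℝ) (x : UnitAddTorus d),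
      convect f (ψ t) x = ∑ i, f x i • partialDeriv i (ψ t) x := fun f t x =>
    fderiv_apply_eq_sum_partialDeriv ((hψt t).isContDiff (by simp)) x (f x)
  -- the weak functional in expanded form
  set I : (UnitAddTorus d → EuclideanSpace ℝ d) → ℝ → ℝ := fun f t =>
    ∫ x, (⟪f x, timeDeriv ψ t x⟫_ℝ + ⟪f x, ∑ i, f x i • partialDeriv i (ψ t) x⟫_ℝ -
      ν * ⟪f x, fracLaplacian θ (ψ t) x⟫_ℝ) with hI_def
  have hIeq : ∀ (f : UnitAddTorus d → EuclideanSpace ℝ d) (t : ℝ),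
      ∫ x, (⟪f x, timeDeriv ψ t x⟫_ℝ + ⟪f x, convect f (ψ t) x⟫_ℝ -
        ν * ⟪f x, fracLaplacian θ (ψ t) x⟫_ℝ) = I f t := by
    intro f t
    simp only [hI_def, hconv]
  have hgoal : (fun t => ∫ x, (⟪w t x, timeDeriv ψ t x⟫_ℝ + ⟪w t x, convect (w t) (ψ t) x⟫_ℝ -
      ν * ⟪w t x, fracLaplacian θ (ψ t) x⟫_ℝ)) = fun t => I (w t) t :=
    funext fun t => hIeq (w t) t
  rw [hgoal]
  -- vanishing off `[a', b']`
  have hI0 : ∀ f t, t ∉ Icc a' b' → I f t = 0 := by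
    intro f t ht
    have h1 : ∀ x, timeDeriv ψ t x = 0 := timeDeriv_eq_zero_of_forall_not_mem_Icc hab' ht
    have h2 : ∀ x i, partialDeriv i (ψ t) x = 0 := fun x i =>
      partialDeriv_slice_eq_zero_of_forall_not_mem_Icc hab' ht i x
    have h3 : ∀ x, fracLaplacian θ (ψ t) x = 0 := fun x => by
      rw [hab' t ht]; exact congrFun (fracLaplacian_zero_fun θ) x
    simp only [hI_def, h1, h2, h3, smul_zero, Finset.sum_const_zero, inner_zero_right, mul_zero,
      add_zero, sub_zero, integral_zero]
  -- continuity of the approximating functionals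
  have hAc : ∀ q, Continuous fun t => I (v q t) t := by
    intro q
    have h := continuous_weakFunctional (ν := ν) hθ (hsol q).smooth_velocity hψ
    simpa only [hIeq] using h
  -- the weak identity with defect
  set B : ℕ → ℝ → ℝ := fun q t => ∫ x, ∑ j, ⟪R q t x j, partialDeriv j (ψ t) x⟫_ℝ with hB_def
  have hAB : ∀ q, ∫ t, I (v q t) t = ∫ t, B q t := by
    intro q
    have h := (hsol q).weak_identity_line hθ hψ hab' hψdiv
    simpa only [hIeq] using h
  have hB0 : ∀ q t, t ∉ Icc a' b' → B q t = 0 := fun q t ht => by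
    simp only [hB_def, partialDeriv_slice_eq_zero_of_forall_not_mem_Icc hab' ht, inner_zero_right,
      Finset.sum_const_zero, integral_zero]
  set L : ℝ := (volume : Measure ℝ).real (Icc a' b') with hL_def
  have hL0 : 0 ≤ L := measureReal_nonneg
  set c₂ : ℝ := Fintype.card d * K₂ with hc₂_def
  have hc₂0 : 0 ≤ c₂ := mul_nonneg (Nat.cast_nonneg _) hK₂0
  have hBsmall : ∀ ε : ℝ, 0 < ε → ∃ N, ∀ q ≥ N, ‖∫ t, B q t‖ ≤ c₂ * ε * L := by
    intro ε hε
    obtain ⟨N, hN⟩ := hR ε hε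
    refine ⟨N, fun q hq => ?_⟩
    rw [← setIntegral_eq_integral_of_forall_compl_eq_zero (fun t ht => hB0 q t ht)]
    refine norm_setIntegral_le_of_norm_le_const measure_Icc_lt_top fun t _ => ?_
    calc ‖B q t‖ ≤ Fintype.card d * K₂ * ∫ x, ‖R q t x‖ :=
          norm_integral_defect_le_integral_norm (hRc q t) (hDc' t) (fun x j => hK₂ t x j)
      _ ≤ Fintype.card d * K₂ * ε := mul_le_mul_of_nonneg_left (hN q hq t) hc₂0
      _ = c₂ * ε := by rw [hc₂_def]
  -- uniform closeness of the functionals along the sequence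
  set Mr : ℝ := M.toReal with hMr_def
  have hMr0 : 0 ≤ Mr := ENNReal.toReal_nonneg
  have hM' : M = ENNReal.ofReal Mr := (ENNReal.ofReal_toReal hMtop).symm
  set c₁ : ℝ := K₁ + |ν| * K₃ with hc₁_def
  have hc₁0 : 0 ≤ c₁ := add_nonneg hK₁0 (mul_nonneg (abs_nonneg ν) hK₃0)
  have hclose : ∀ δ : ℝ, 0 < δ → ∃ N, ∀ q ≥ N, ∀ t,
      ‖I (v q t) t - I (w t) t‖ ≤ c₁ * δ + c₂ * (δ * (Mr + Mr)) := by
    intro δ hδ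
    obtain ⟨N, hN⟩ := hT0 (ENNReal.ofReal δ) (ENNReal.ofReal_pos.2 hδ)
    refine ⟨N, fun q hq t => ?_⟩
    have h : ‖I (v q t) t - I (w t) t‖ₑ ≤
        ENNReal.ofReal c₁ * eLpNorm (v q t - w t) 2 volume +
          ENNReal.ofReal c₂ * (eLpNorm (v q t - w t) 2 volume *
            (eLpNorm (v q t) 2 volume + eLpNorm (w t) 2 volume)) :=
      enorm_integral_fullIntegrand_sub_le (ν := ν) (hvL2 q t) (hwL2 t)
        (hPc t).aestronglyMeasurable (fun i => (hDc t i).aestronglyMeasurable)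
        (hLc t).aestronglyMeasurable hK₁0 hK₂0 hK₃0 (hK₁ t) (fun x i => hK₂ t x i) (hK₃ t)
    have hd : eLpNorm (v q t - w t) 2 volume ≤ ENNReal.ofReal δ := by
      rw [eLpNorm_sub_comm]; exact hN q hq t
    have e : ENNReal.ofReal (c₁ * δ + c₂ * (δ * (Mr + Mr))) =
        ENNReal.ofReal c₁ * ENNReal.ofReal δ +
          ENNReal.ofReal c₂ * (ENNReal.ofReal δ * (M + M)) := by
      rw [hM', ENNReal.ofReal_add (by positivity) (by positivity), ENNReal.ofReal_mul hc₁0,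
        ENNReal.ofReal_mul hc₂0, ENNReal.ofReal_mul hδ.le, ENNReal.ofReal_add hMr0 hMr0]
    have h2 : ‖I (v q t) t - I (w t) t‖ₑ ≤ ENNReal.ofReal (c₁ * δ + c₂ * (δ * (Mr + Mr))) := by
      refine h.trans ?_
      rw [e]
      exact add_le_add (mul_le_mul' le_rfl hd)
        (mul_le_mul' le_rfl (mul_le_mul' hd (add_le_add (hMv q t) (hMw t))))
    rw [← ofReal_norm] at h2
    exact (ENNReal.ofReal_le_ofReal_iff (by positivity)).1 h2
  set S : ℝ := c₁ + c₂ * (Mr + Mr) with hS_def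
  have hS0 : 0 ≤ S := by positivity
  have hcloseS : ∀ δ : ℝ, 0 < δ → ∃ N, ∀ q ≥ N, ∀ t, ‖I (v q t) t - I (w t) t‖ ≤ δ * S := by
    intro δ hδ
    obtain ⟨N, hN⟩ := hclose δ hδ
    refine ⟨N, fun q hq t => (hN q hq t).trans (le_of_eq ?_)⟩
    rw [hS_def]; ring
  -- continuity of `t ↦ I (w t) t` (uniform limit of continuous functions)
  have hIwc : Continuous fun t => I (w t) t := by
    refine TendstoUniformly.continuous (F := fun q t => I (v q t) t) (p := atTop) ?_
      (Eventually.of_forall hAc).frequently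
    rw [Metric.tendstoUniformly_iff]
    intro ε hε
    obtain ⟨N, hN⟩ := hcloseS (ε / (2 * (S + 1))) (by positivity)
    refine eventually_atTop.2 ⟨N, fun q hq t => ?_⟩
    rw [dist_eq_norm, ← norm_neg, neg_sub]
    refine (hN q hq t).trans_lt ?_
    calc ε / (2 * (S + 1)) * S ≤ ε / (2 * (S + 1)) * (S + 1) :=
          mul_le_mul_of_nonneg_left (by linarith) (by positivity)
      _ = ε / 2 := by field_simp
      _ < ε := half_lt_self hε
  -- integrability on the time line
  have hIw0 : ∀ t, t ∉ Icc a' b' → I (w t) t = 0 := fun t ht => hI0 (w t) t ht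
  have hIwint : Integrable (fun t => I (w t) t) volume :=
    hIwc.integrable_of_hasCompactSupport (HasCompactSupport.intro isCompact_Icc hIw0)
  have hAint : ∀ q, Integrable (fun t => I (v q t) t) volume := fun q =>
    (hAc q).integrable_of_hasCompactSupport
      (HasCompactSupport.intro isCompact_Icc fun t ht => hI0 (v q t) t ht)
  -- conclusion: `∫ I(w) = lim ∫ I(v_q) = lim ∫ B_q = 0`
  refine norm_le_zero_iff.1 (le_of_forall_pos_le_add fun ε hε => ?_)
  rw [zero_add]
  obtain ⟨N₁, hN₁⟩ := hcloseS (ε / (2 * (L + 1) * (S + 1))) (by positivity)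
  obtain ⟨N₂, hN₂⟩ := hBsmall (ε / (2 * (L + 1) * (c₂ + 1))) (by positivity)
  set q : ℕ := max N₁ N₂ with hq_def
  have h1 : ‖(∫ t, I (v q t) t) - ∫ t, I (w t) t‖ ≤ ε / 2 := by
    rw [← integral_sub (hAint q) hIwint]
    have hvan : ∀ t, t ∉ Icc a' b' → I (v q t) t - I (w t) t = 0 := fun t ht => by
      rw [hI0 (v q t) t ht, hIw0 t ht, sub_zero]
    rw [← setIntegral_eq_integral_of_forall_compl_eq_zero hvan]
    calc ‖∫ t in Icc a' b', (I (v q t) t - I (w t) t)‖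
        ≤ ε / (2 * (L + 1) * (S + 1)) * S * L :=
          norm_setIntegral_le_of_norm_le_const measure_Icc_lt_top fun t _ =>
            hN₁ q (le_max_left _ _) t
      _ ≤ ε / (2 * (L + 1) * (S + 1)) * (S + 1) * (L + 1) := by
          apply mul_le_mul _ (by linarith) hL0 (by positivity)
          exact mul_le_mul_of_nonneg_left (by linarith) (by positivity)
      _ = ε / 2 := by field_simp
  have h2 : ‖∫ t, I (v q t) t‖ ≤ ε / 2 := by
    rw [hAB q]
    refine (hN₂ q (le_max_right _ _)).trans ?_
    calc c₂ * (ε / (2 * (L + 1) * (c₂ + 1))) * L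
        ≤ (c₂ + 1) * (ε / (2 * (L + 1) * (c₂ + 1))) * (L + 1) := by
          apply mul_le_mul _ (by linarith) hL0 (by positivity)
          exact mul_le_mul_of_nonneg_right (by linarith) (by positivity)
      _ = ε / 2 := by field_simp
  calc ‖∫ t, I (w t) t‖ ≤ ‖∫ t, I (v q t) t‖ + ‖(∫ t, I (v q t) t) - ∫ t, I (w t) t‖ :=
        norm_le_insert _ _
    _ ≤ ε / 2 + ε / 2 := add_le_add h2 h1
    _ = ε := by ring

/-- **`C⁰_t L²_x` limits of fractional Navier–Stokes–Reynolds flows with vanishing stress are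
weak solutions on the time line** (the limit step in the proof of Luo–Titi 2020, Theorem 1,
p. 4 of the arXiv text: "`∑ ‖v_{q+1} - v_q‖_{L^∞_t L²_x} < ∞`. Thus `v_q` converge strongly to
some `v ∈ C⁰_t L²_x`. Since `‖R_{q+1}‖_{L^∞_t L¹_x} → 0`, as `q → ∞`, `v` is a weak solution to the
FVNSE (1.1)"). Precisely: let `(v_q, p_q, R_q)` be classical solutions of the fractional
Navier–Stokes–Reynolds system on `ℝ × T^d` (`θ ≥ 0`), all `v_q` vanishing off a fixed bounded
time interval `(a, b)`, with `sup_t ‖v_{q+1}(t) - v_q(t)‖_{L²} ≤ β_q`, `∑ β_q < ∞`, and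
`sup_t ‖R_q(t)‖_{L¹} → 0`. Then the slice-wise limit `v = stLim v_•` (the `C⁰_t L²_x` limit:
`sup_t ‖v(t) - v_q(t)‖_{L²} ≤ ∑_{k ≥ q} β_k`) is a weak solution in the sense of Luo–Titi's
Def. 1.1 (`Torus.IsWeakFracNSSolutionLine`): measurable on `ℝ × T^d`, every slice in `L²`,
weakly (indeed strongly) `L²`-continuous in time, weakly divergence free, and the momentum
identity (`integral_weakFunctional_stLim_eq_zero`).
[cite: LuoTiti2020, §2.1 proof of Theorem 1 (p. 4 of arXiv:1808.07595)] -/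
theorem isWeakFracNSSolutionLine_stLim (hθ : 0 ≤ θ)
    {v : ℕ → ℝ → UnitAddTorus d → EuclideanSpace ℝ d} {p : ℕ → ℝ → UnitAddTorus d → ℝ}
    {R : ℕ → ℝ → UnitAddTorus d → d → EuclideanSpace ℝ d}
    (hsol : ∀ q, IsFracNSReynoldsOn univ θ ν (v q) (p q) (R q))
    {a b : ℝ} (hsupp : ∀ q t, t ∉ Ioo a b → v q t = 0)
    {β : ℕ → ℝ≥0∞} (hβ : ∀ q t, eLpNorm (v (q + 1) t - v q t) 2 volume ≤ β q)
    (hβs : ∑' q, β q ≠ ⊤)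
    (hR : ∀ ε : ℝ, 0 < ε → ∃ N, ∀ q ≥ N, ∀ t, ∫ x, ‖R q t x‖ ≤ ε) :
    IsWeakFracNSSolutionLine θ ν (stLim v) := by
  borelize (EuclideanSpace ℝ d)
  have hcont : ∀ q, Continuous (Function.uncurry (v q)) := fun q =>
    continuous_uncurry_of_isSmoothSpaceTimeOn (hsol q).smooth_velocity
  obtain ⟨M, hMtop, hwm, hvL2, hwL2, hMv, hMw, -, hT0⟩ := stLim_L2_facts hcont (hsupp 0) hβ hβs
  have hsm : ∀ q t, IsSmooth (v q t) := fun q t =>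
    (hsol q).smooth_velocity.isSmooth_slice (mem_univ t)
  refine ⟨?_, hwL2, ?_, ?_, ?_⟩
  -- (1) measurability of the space–time lift
  · have hprod : AEStronglyMeasurable (Function.uncurry (stLim v))
        (((volume : Measure ℝ).restrict univ).prod (volume : Measure (UnitAddTorus d))) := by
      rw [Measure.restrict_univ]
      exact aestronglyMeasurable_uncurry_stLim hcont hβ hβs
    have h := aestronglyMeasurable_stLift_of_uncurry hprod
    rwa [univ_prod_univ, Measure.restrict_univ] at h
  -- (3) weak (indeed strong) continuity in `L²`
  · intro φ hφ
    have hvq : ∀ q, Continuous fun t => ∫ x, ⟪v q t x, φ x⟫_ℝ := fun q => by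
      obtain ⟨C, -, hC⟩ := exists_bound_of_continuous_of_support (hcont q) (hsupp q)
      exact continuous_integral_inner_of_bound (hcont q) hC hφ
    exact continuous_integral_inner_of_unifL2 hφ hvq hwL2 hvL2 hT0
  -- (4) weak incompressibility of every slice
  · intro t ξ hξ
    have hgL2 : MemLp (Torus.gradient ξ) 2 volume := hξ.gradient.memLp 2
    have h0 : ∀ q, ∫ x, ⟪v q t x, Torus.gradient ξ x⟫_ℝ = 0 := fun q =>
      ((hsol q).divFree t (mem_univ t)).isWeaklyDivFree_holds (hsm q t) ξ hξ
    refine norm_le_zero_iff.1 (le_of_forall_pos_le_add fun ε hε => ?_)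
    rw [zero_add]
    have hGfin : eLpNorm (Torus.gradient ξ) 2 volume < ⊤ := hgL2.eLpNorm_lt_top
    set G : ℝ := (eLpNorm (Torus.gradient ξ) 2 volume).toReal with hG_def
    have hG0 : 0 ≤ G := ENNReal.toReal_nonneg
    obtain ⟨N, hN⟩ := hT0 (ENNReal.ofReal (ε / (G + 1))) (ENNReal.ofReal_pos.2 (by positivity))
    have i1 : Integrable (fun x => ⟪stLim v t x, Torus.gradient ξ x⟫_ℝ) volume :=
      integrable_real_inner_of_memLp (hwL2 t) hgL2
    have i2 : Integrable (fun x => ⟪v N t x, Torus.gradient ξ x⟫_ℝ) volume :=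
      integrable_real_inner_of_memLp (hvL2 N t) hgL2
    have hsub : ∫ x, ⟪stLim v t x, Torus.gradient ξ x⟫_ℝ =
        ∫ x, ⟪(stLim v t - v N t) x, Torus.gradient ξ x⟫_ℝ := by
      rw [show (∫ x, ⟪stLim v t x, Torus.gradient ξ x⟫_ℝ) =
          (∫ x, ⟪stLim v t x, Torus.gradient ξ x⟫_ℝ) - ∫ x, ⟪v N t x, Torus.gradient ξ x⟫_ℝ by
          rw [h0 N, sub_zero], ← integral_sub i1 i2]
      refine integral_congr_ae (ae_of_all _ fun x => ?_)
      simp only [Pi.sub_apply, inner_sub_left]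
    rw [hsub]
    have hfin : eLpNorm (stLim v t - v N t) 2 volume * eLpNorm (Torus.gradient ξ) 2 volume ≠ ⊤ :=
      ENNReal.mul_ne_top ((hwL2 t).sub (hvL2 N t)).eLpNorm_ne_top hGfin.ne
    calc ‖∫ x, ⟪(stLim v t - v N t) x, Torus.gradient ξ x⟫_ℝ‖
        ≤ (eLpNorm (stLim v t - v N t) 2 volume * eLpNorm (Torus.gradient ξ) 2 volume).toReal :=
          norm_integral_inner_le_toReal ((hwL2 t).sub (hvL2 N t)).1 hgL2.1 hfin
      _ ≤ (ENNReal.ofReal (ε / (G + 1)) * eLpNorm (Torus.gradient ξ) 2 volume).toReal :=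
          ENNReal.toReal_mono (ENNReal.mul_ne_top ENNReal.ofReal_ne_top hGfin.ne)
            (mul_le_mul' (hN N le_rfl t) le_rfl)
      _ = ε / (G + 1) * G := by
          rw [ENNReal.toReal_mul, ENNReal.toReal_ofReal (by positivity)]
      _ ≤ ε := by
          have h1 : ε / (G + 1) * G ≤ ε / (G + 1) * (G + 1) :=
            mul_le_mul_of_nonneg_left (by linarith) (by positivity)
          have h2 : ε / (G + 1) * (G + 1) = ε := by field_simp
          linarith
  -- (5) the momentum identity
  · rintro ψ hψ ⟨a', b', hab'⟩ hψdiv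
    exact integral_weakFunctional_stLim_eq_zero hθ hsol hsupp hβ hβs hR hψ hab' hψdiv

end LimitTheorem

end Torus

end Literature.Analysis.FluidPDE
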